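import Mathlib
import Summits.MatrixMultiplication.MatrixMultiplication.Theorems.ThinBlockAlphaThinPackingsStubGeneralBridge

set_option linter.dupNamespace false

/-!
# Stub `stub_pairCollapse` — the three packings of an orthogonal three-sphere frame family give an STPP

Crux `stmt-MatrixMultiplication-10595` (`Theses.ThinBlockAlpha.ThinPackings`), line
`three-sphere-frame-designs`.

Blocks are ORTHOGONAL THREE-SPHERE FRAMES of `ℤ^D`: within block `i` the legs `A i`, `B i`, `C i` are
pointwise orthogonal and lie on the spheres of CONSTANT squared radii `rA`, `rB`, `rC`.  For such a
family the three packings (a difference `z − x`, `y − x`, `y − z` across two legs determines its block)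
together with the all-distinct-label clause already give `IsSTPP A B C`.

Proof: (1) inside one frame a difference across two orthogonal legs determines both endpoints
(`c − a = c' − a'` gives `c − c' = a − a'`, a vector orthogonal to itself, hence zero by
`dotProduct_self_eq_zero`), so the packings upgrade to the strong form `… → i = k ∧ a = a' ∧ c = c'`;
(2) the landed bridge `stub_generalBridge` (p81634) with the constant radii `fun _ => rA`, … (its three
order-compatibility premises are then vacuous) and zero potentials yields
`IsLabelWeightedSTPP A B C 0 0`; (3) constant potentials collapse to `IsSTPP`
(`Negative.Triage2.isSTPP_comp_of_const_potentials` with `ι = id`).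
-/

namespace Summit.MatrixMultiplication.MatrixMultiplication.Theorems.ThinPackings

open Summit.MatrixMultiplication.MatrixMultiplication.Theorems.ThinPackings.Negative.Triage2 (IsLabelWeightedSTPP)

/-- Inside one orthogonal frame a difference across two orthogonal legs determines both endpoints:
if `a, a'` are orthogonal to `c, c'` and `c - a = c' - a'`, then `a = a'` and `c = c'`
(the vector `c - c' = a - a'` is orthogonal to itself, hence zero in `ℤ^D`). -/
theorem PairCollapse.endpoints_eq {D : ℕ} {a a' c c' : Fin D → ℤ}
    (h1 : a ⬝ᵥ c = 0) (h2 : a ⬝ᵥ c' = 0) (h3 : a' ⬝ᵥ c = 0) (h4 : a' ⬝ᵥ c' = 0)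
    (h : c - a = c' - a') : a = a' ∧ c = c' := by
  have hd : c - c' = a - a' := sub_eq_sub_iff_sub_eq_sub.mp h
  have horth : (a - a') ⬝ᵥ (c - c') = 0 := GradedFrames.sub_dotProduct_sub_eq_zero h4 h3 h2 h1
  rw [← hd] at horth
  have hc : c - c' = 0 := dotProduct_self_eq_zero.mp horth
  have ha : a - a' = 0 := by rw [← hd]; exact hc
  exact ⟨sub_eq_zero.mp ha, sub_eq_zero.mp hc⟩

/-- **stub_pairCollapse** — THREE PACKINGS OF A CONSTANT-RADIUS FRAME FAMILY GIVE AN STPP.  For an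
orthogonal frame family in `ℤ^D` (legs pairwise pointwise orthogonal) on spheres of constant squared
radii `rA`, `rB`, `rC`, the three packings (`z − x`, `y − x`, `y − z` determine their block) together with
the all-distinct-label clause imply `IsSTPP A B C`.  The constant-radius, zero-potential instance of the
bridge `stub_generalBridge` of line `label-weighted-stpp-debordering`, collapsed to `IsSTPP` by
`Negative.Triage2.isSTPP_comp_of_const_potentials`. [new, elementary: Pythagoras in `ℤ^D`] -/
theorem stub_pairCollapse :
    ∀ (D L : ℕ) (A B C : Fin L → Finset (Fin D → ℤ)) (rA rB rC : ℤ),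
      (∀ i, ∀ x ∈ A i, x ⬝ᵥ x = rA) → (∀ i, ∀ y ∈ B i, y ⬝ᵥ y = rB) →
      (∀ i, ∀ z ∈ C i, z ⬝ᵥ z = rC) →
      (∀ i, ∀ x ∈ A i, ∀ y ∈ B i, x ⬝ᵥ y = 0) → (∀ i, ∀ x ∈ A i, ∀ z ∈ C i, x ⬝ᵥ z = 0) →
      (∀ i, ∀ y ∈ B i, ∀ z ∈ C i, y ⬝ᵥ z = 0) →
      (∀ i k, ∀ x ∈ A i, ∀ z ∈ C i, ∀ x' ∈ A k, ∀ z' ∈ C k, z - x = z' - x' → i = k) →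
      (∀ i k, ∀ x ∈ A i, ∀ y ∈ B i, ∀ x' ∈ A k, ∀ y' ∈ B k, y - x = y' - x' → i = k) →
      (∀ i k, ∀ y ∈ B i, ∀ z ∈ C i, ∀ y' ∈ B k, ∀ z' ∈ C k, y - z = y' - z' → i = k) →
      (∀ i j k : Fin L, i ≠ j → j ≠ k → i ≠ k →
        ∀ s ∈ A k, ∀ s' ∈ A i, ∀ t ∈ B i, ∀ t' ∈ B j, ∀ u ∈ C j, ∀ u' ∈ C k,
          (s' - s) + (t' - t) + (u' - u) ≠ 0) →
      Literature.Computability.AlgebraicComplexity.IsSTPP A B C := by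
  intro D L A B C rA rB rC hnA hnB hnC hAB hAC hBC hP1 hP2 hP3 hDist
  -- (1) the packings in strong form: the block AND both endpoints are determined
  have R1 : ∀ i k, ∀ a ∈ A i, ∀ c ∈ C i, ∀ a' ∈ A k, ∀ c' ∈ C k,
      c - a = c' - a' → i = k ∧ a = a' ∧ c = c' := by
    intro i k a ha c hc a' ha' c' hc' h
    obtain rfl := hP1 i k a ha c hc a' ha' c' hc' h
    exact ⟨rfl, PairCollapse.endpoints_eq (hAC i a ha c hc) (hAC i a ha c' hc')
      (hAC i a' ha' c hc) (hAC i a' ha' c' hc') h⟩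
  have R2 : ∀ i k, ∀ a ∈ A i, ∀ b ∈ B i, ∀ a' ∈ A k, ∀ b' ∈ B k,
      b - a = b' - a' → i = k ∧ a = a' ∧ b = b' := by
    intro i k a ha b hb a' ha' b' hb' h
    obtain rfl := hP2 i k a ha b hb a' ha' b' hb' h
    exact ⟨rfl, PairCollapse.endpoints_eq (hAB i a ha b hb) (hAB i a ha b' hb')
      (hAB i a' ha' b hb) (hAB i a' ha' b' hb') h⟩
  have R3 : ∀ i k, ∀ b ∈ B i, ∀ c ∈ C i, ∀ b' ∈ B k, ∀ c' ∈ C k,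
      b - c = b' - c' → i = k ∧ b = b' ∧ c = c' := by
    intro i k b hb c hc b' hb' c' hc' h
    obtain rfl := hP3 i k b hb c hc b' hb' c' hc' h
    obtain ⟨hcc, hbb⟩ := PairCollapse.endpoints_eq
      (by rw [dotProduct_comm]; exact hBC i b hb c hc)
      (by rw [dotProduct_comm]; exact hBC i b' hb' c hc)
      (by rw [dotProduct_comm]; exact hBC i b hb c' hc')
      (by rw [dotProduct_comm]; exact hBC i b' hb' c' hc') h
    exact ⟨rfl, hbb, hcc⟩
  -- (2) the bridge with constant radii and zero potentials (order-compatibility is vacuous)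
  have hW : IsLabelWeightedSTPP A B C (fun _ => 0) (fun _ => 0) :=
    (stub_generalBridge D L A B C (fun _ => rA) (fun _ => rB) (fun _ => rC) (fun _ => 0) (fun _ => 0)
      ⟨hAB, hAC, hBC⟩ ⟨hnA, hnB, hnC⟩
      ⟨fun _ _ h => absurd h (lt_irrefl _), fun _ _ h => absurd h (lt_irrefl _),
        fun _ _ h => absurd h (lt_irrefl _)⟩).mpr
      ⟨R1, R2, R3, fun i j k hij hjk hik _ => hDist i j k hij hjk hik⟩
  -- (3) constant potentials collapse to the STPP (`ι = id`)
  exact Negative.Triage2.isSTPP_comp_of_const_potentials hW id Function.injective_id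
    (fun _ _ => rfl) (fun _ _ => rfl)

end Summit.MatrixMultiplication.MatrixMultiplication.Theorems.ThinPackings
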